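import Summits.BirchSwinnertonDyer.Rank1Residual.WAll.TargetAdditiveAtThreePotSSImage
import Summits.BirchSwinnertonDyer.Rank1Residual.Additive.WildThreeKrausCells
import HarnessLib
import Summits.BirchSwinnertonDyer.BirchSwinnertonDyer.Theses.CyclotomicUntwist
import Summits.BirchSwinnertonDyer.BirchSwinnertonDyer.Theorems.CyclotomicUntwistPSRankOneUpperHalfAtThreeNonTower

/-! BC3 birth skeleton for crux `PSRankOneUpperHalfAtThree`: split by 3-adic TOWER surjectivity
(Kolyvagin's Čebotarev step at level 3^M needs ρ_{3^∞} onto; the non-tower onto rows are the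
SOED residual `NonTower`, shared obstacle).

v2 (bsd-line-cycu-p4 g3, 2026-08-28): stub 2 `stub_upperHalf_nonTower` is CLOSED — PROVED BY NAME (vacuously) in
`Theorems/CyclotomicUntwistPSRankOneUpperHalfAtThreeNonTower.lean` (p600944, registered signature verbatim): on every
principal-series row (`Addv W 3`, `Surj W 3`, `v₃(Δ_min)` even) the 3-adic tower HOLDS (`PSTowerOfEven.towerSurj_three_of_addv_of_surj_of_even`:
`v₃(j − 1728) = 2v₃(c₆) − v₃(Δ_min)` is even ≠ 3, and the tree's `ClassX4.towerSurj_three_of_surj_of_padicValRat_j_sub_ne`).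
The landed theorem is imported above and used by name in the composition; sorries = 1 = the one open stub `stub_upperHalf_tower`
(= the whole crux on its rows: Kolyvagin–Jetchev at 3 WITH the tower given). -/

set_option linter.dupNamespace false
noncomputable section
open scoped Classical
open WeierstrassCurve Literature.NumberTheory.EllipticCurves
  Literature.NumberTheory.EllipticCurves.Rank1Residual

namespace Summit.BirchSwinnertonDyer.BirchSwinnertonDyer.Cruxes.PSRankOneUpperHalfAtThree.Birth

/-- stub 1 (size L): upper half on the principal-series rows with 3-ADIC TOWER surjectivity —
Kolyvagin1990 at p = 3 with Jetchev2008 Tamagawa sharpening (c₃ ∈ {1,3}) and Gross–Zagier. -/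
theorem stub_upperHalf_tower :
    ∀ (W : WeierstrassCurve ℚ) [W.IsElliptic] [W.IsGloballyMinimal],
      ¬ W.HasCM → Summit.BirchSwinnertonDyer.Rank1Residual.Additive.ClassO6 W 3 → Surj W 3 →
      (∀ n : ℕ, W.HasSurjectiveModNGaloisRep (3 ^ n : ℕ)) →
      Even (padicValInt 3 W.minimalDiscriminantInt) →
      W.minimalDiscriminantInt / 3 ^ padicValInt 3 W.minimalDiscriminantInt % 3 = 1 →
      W.analyticRank = 1 → Typed.MissingUpperBoundAt W 3 := by
  sorry

/-! stub 2 `stub_upperHalf_nonTower` is CLOSED (vacuous): the landed theorem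
`Summit.BirchSwinnertonDyer.BirchSwinnertonDyer.Cruxes.PSRankOneUpperHalfAtThree.Birth.stub_upperHalf_nonTower`
(`Theorems/CyclotomicUntwistPSRankOneUpperHalfAtThreeNonTower.lean`, cycu-p4 g3, p600944) is imported above. -/

/-- COMPOSITION (line `birth`): the route crux BY NAME from the two registered stubs, by the case split on 3-adic
TOWER surjectivity (`stub_upperHalf_tower` / `stub_upperHalf_nonTower`, the latter LANDED and vacuous). Sorry-free.
(Hypothesis-free form required by `ledger skeleton check`: stubs are cited by name, not passed as binders.) -/
theorem PSRankOneUpperHalfAtThree_of :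
    Summit.BirchSwinnertonDyer.BirchSwinnertonDyer.Theses.CyclotomicUntwist.PSRankOneUpperHalfAtThree := by
  intro W _ _ hCM hO6 hsurj hev hsq hr
  by_cases ht : ∀ n : ℕ, W.HasSurjectiveModNGaloisRep (3 ^ n : ℕ)
  · exact stub_upperHalf_tower W hCM hO6 hsurj ht hev hsq hr
  · exact stub_upperHalf_nonTower W hCM hO6 hsurj ht hev hsq hr

end Summit.BirchSwinnertonDyer.BirchSwinnertonDyer.Cruxes.PSRankOneUpperHalfAtThree.Birth
end
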